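import Mathlib
import Summits.Ventures.PercRepro2.LocRows
import Summits.Ventures.PercRepro2.SwRow
import Summits.Ventures.PercRepro2.SwOut
import Summits.Ventures.PercRepro2.SwAllRow
import Summits.Ventures.PercRepro2.SwOutAll
import Summits.Ventures.PercRepro2.SwOutArmFlip
import Summits.Ventures.PercRepro2.SwOutArms
import Summits.Ventures.PercRepro2.SwOutArmOrbit
import Summits.Ventures.PercRepro2.SwOutArmCube
import Summits.Ventures.PercRepro2.SwOutArmThm
import Summits.Ventures.PercRepro2.SwOutCoreDefs
import Summits.Ventures.PercRepro2.SwOutCoreKey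
import Summits.Ventures.PercRepro2.SwOutCoreShadowUnion
import Summits.Ventures.PercRepro2.SwOutBigBlockDefs
import Summits.Ventures.PercRepro2.SwOutMixedBaseDefs
import Summits.Ventures.PercRepro2.SwOutMixedBaseClasses
import Summits.Ventures.PercRepro2.SwOutMixedBaseHull
import Summits.Ventures.PercRepro2.SwOutMixedBaseDual
import Summits.Ventures.PercRepro2.SwOutMixedCore
import Summits.Ventures.PercRepro2.SwOutMixedPartCoreKey

/-!
# The coarse orbits of a mixed block: the closed unions of classes (blind cell PercRepro2,
night-4 g19, 2026-08-27; proofs/NIGHT4-G19.md §5 (ii))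

At a non-leaking point `q` of the raw cube of a mixed base whose arms are CONNECTED (each u-arm,
the h-piece and each far arm connected inside itself) a union `W` of coarse arms of the
realisation — an arm-closed set (`armClosed_armsUnion`) — contains or misses every class
(`subset_or_disjoint_of_armClosed`), contains `u` iff it contains the u-arms (`U_subset_iff`),
contains the h-piece iff it contains `p` when `p` lies in the hull (`Ah_subset_iff`,
`Ah_subset_of_mem`), contains `u` when it contains `p` (`u_mem_of_p_mem`) and misses every vertex
outside `{h, u, p}` and the arms (`not_mem_W_of_out`).  Also: at a non-leaking point every arm
vertex lies in the hull of `h` (`armsAll_subset_hull`) and so does `u` (`u_mem_hull`).  `toggleW`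
is the cube point with the classes inside `W` toggled; the flip identity is in
`SwOutMixedPartOrbit`.
-/


namespace Summit.Ventures.PercRepro2

namespace BigBlock

open Hull LocRows

variable {V : Type*} {E : Type*}

open scoped Classical

section Closed

variable {ends : E → Sym2 V} {ζ : Config E} {h : V}

/-- A union of coarse arms is arm-closed. -/
lemma armClosed_armsUnion [Fintype E] [DecidableEq E] (P : Set V → Prop) :
    ArmClosed ends ζ h (armsUnion (arms ends ζ h) P) := by
  have : armsUnion (arms ends ζ h) P = ⋃ Q : {Q : Set V // Q ∈ arms ends ζ h ∧ P Q}, Q.1 := by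
    ext x
    simp only [mem_armsUnion_iff, Set.mem_iUnion, Subtype.exists, exists_prop]
    constructor
    · rintro ⟨Q, hQ, hPQ, hx⟩; exact ⟨Q, ⟨hQ, hPQ⟩, hx⟩
    · rintro ⟨Q, ⟨hQ, hPQ⟩, hx⟩; exact ⟨Q, hQ, hPQ, hx⟩
  rw [this]
  exact armClosed_iUnion _ fun Q => armClosed_of_mem_arms Q.2.1

/-- A set connected inside itself and lying in `hull ∖ {h}` is contained in, or disjoint from,
every arm-closed set. -/
lemma subset_or_disjoint_of_armClosed {W S : Set V} (hW : ArmClosed ends ζ h W)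
    (hS : ∀ x ∈ S, x ∈ hull ends ζ h ∧ x ≠ h)
    (hconn : ∀ x ∈ S, ∀ y ∈ S, y ∈ cluster ends (fun e => decide (e ∈ within ends S)) x) :
    S ⊆ W ∨ ∀ x ∈ S, x ∉ W := by
  by_cases hex : ∃ x ∈ S, x ∈ W
  · obtain ⟨x₀, hx₀S, hx₀W⟩ := hex
    left
    intro y hy
    have key : y ∈ {v | v ∉ S ∨ v ∈ W} := by
      refine mem_of_conn_of_closed (ends := ends) (ω := fun e => decide (e ∈ within ends S)) ?_
        (Or.inr hx₀W) (hconn x₀ hx₀S y hy)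
      intro a ha b hab
      obtain ⟨_, e, he, hends⟩ := openGraph_adj.1 hab
      have hin : e ∈ within ends S := by simpa using he
      obtain ⟨a', ha', b', hb', hab'⟩ := hin
      rw [hends, Sym2.eq_iff] at hab'
      have haS : a ∈ S := by
        rcases hab' with ⟨h1, _⟩ | ⟨h1, _⟩
        · rw [h1]; exact ha'
        · rw [h1]; exact hb'
      have hbS : b ∈ S := by
        rcases hab' with ⟨_, h2⟩ | ⟨_, h2⟩
        · rw [h2]; exact hb'
        · rw [h2]; exact ha'
      rcases ha with ha | ha
      · exact absurd haS ha
      · exact Or.inr (hW.closed e a b hends ha (hS b hbS).1 (hS b hbS).2)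
    rcases key with h' | h'
    · exact absurd hy h'
    · exact h'
  · right
    intro x hx hxW
    exact hex ⟨x, hx, hxW⟩

end Closed

section Orbit

variable {ι κ : Type*} {ends : E → Sym2 V} {σ : Config E} {h u p : V} {U : ι → Set V} {Ah : Set V}
  {F : κ → Set V}

/-- The point with the classes inside `W` toggled. -/
noncomputable def toggleW (u p : V) (U : ι → Set V) (Ah : Set V) (F : κ → Set V) (q : Pt ι κ)
    (W : Set V) : Pt ι κ :=
  (fun j => if U j ⊆ W then !q.1 j else q.1 j, if Ah ⊆ W then !q.2.1 else q.2.1,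
    if u ∈ W then !q.2.2.1 else q.2.2.1, if p ∈ W then !q.2.2.2.1 else q.2.2.2.1,
    fun k => if F k ⊆ W then !q.2.2.2.2 k else q.2.2.2.2 k)

variable (hb : MixedBase ends σ h u p U Ah F)
include hb

/-- Every arm vertex lies in the hull of `h` at a non-leaking point. -/
theorem MixedBase.armsAll_subset_hull (hup : ∃ e, ends e = s(u, p)) {q : Pt ι κ}
    (hqR : ¬ LeakR q) (hqB : ¬ LeakB q) {x : V} (hx : x ∈ armsAll U Ah F) :
    x ∈ hull ends (mixedReal ends u p U Ah F σ q) h := by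
  have hR := hb.cluster_mixedReal hup hqR
  have hB := hb.cluster_blue_mixedReal hup hqB
  rcases hx with (hx | hx) | hx
  · obtain ⟨j, hj⟩ := Set.mem_iUnion.1 hx
    cases hs : q.1 j with
    | true =>
      left; rw [hR, mem_redSetM_iff]; exact Or.inr (Or.inl ⟨j, hs, hj⟩)
    | false =>
      right; rw [hB, mem_redSetM_iff]
      refine Or.inr (Or.inl ⟨j, ?_, hj⟩)
      simp only [flipPt, flipAll, hs, Bool.not_false]
  · cases ha : q.2.1 with
    | true =>
      left; rw [hR, mem_redSetM_iff]; exact Or.inr (Or.inr (Or.inr (Or.inr (Or.inl ⟨ha, hx⟩))))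
    | false =>
      right; rw [hB, mem_redSetM_iff]
      refine Or.inr (Or.inr (Or.inr (Or.inr (Or.inl ⟨?_, hx⟩))))
      simp only [flipPt, ha, Bool.not_false]
  · obtain ⟨k, hk⟩ := Set.mem_iUnion.1 hx
    cases hf : q.2.2.2.2 k with
    | true =>
      left; rw [hR, mem_redSetM_iff]; exact Or.inr (Or.inr (Or.inr (Or.inr (Or.inr ⟨k, hf, hk⟩))))
    | false =>
      right; rw [hB, mem_redSetM_iff]
      refine Or.inr (Or.inr (Or.inr (Or.inr (Or.inr ⟨k, ?_, hk⟩))))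
      simp only [flipPt, flipAll, hf, Bool.not_false]

/-- `u` lies in the hull of `h` at a non-leaking point (some u-arm exists). -/
theorem MixedBase.u_mem_hull [Nonempty ι] (hup : ∃ e, ends e = s(u, p)) {q : Pt ι κ}
    (hqR : ¬ LeakR q) (hqB : ¬ LeakB q) : u ∈ hull ends (mixedReal ends u p U Ah F σ q) h := by
  obtain ⟨j⟩ := ‹Nonempty ι›
  cases hj : q.1 j with
  | true =>
    left
    rw [hb.cluster_mixedReal hup hqR, mem_redSetM_iff]
    exact Or.inr (Or.inr (Or.inl ⟨rfl, j, hj⟩))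
  | false =>
    right
    rw [hb.cluster_blue_mixedReal hup hqB, mem_redSetM_iff]
    refine Or.inr (Or.inr (Or.inl ⟨rfl, j, ?_⟩))
    simp only [flipPt, flipAll, hj, Bool.not_false]

section Flip

variable (hup : ∃ e, ends e = s(u, p)) (hdead : ∃ e y, ends e = s(p, y) ∧ y ∈ Ah)
  (hconnU : ∀ j, ∀ x ∈ U j, ∀ y ∈ U j, y ∈ cluster ends (fun e => decide (e ∈ within ends (U j))) x)
  (hconnA : ∀ x ∈ Ah, ∀ y ∈ Ah, y ∈ cluster ends (fun e => decide (e ∈ within ends Ah)) x)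
  (hconnF : ∀ k, ∀ x ∈ F k, ∀ y ∈ F k, y ∈ cluster ends (fun e => decide (e ∈ within ends (F k))) x)
  {q : Pt ι κ} (hqR : ¬ LeakR q) (hqB : ¬ LeakB q)
  {W : Set V} (hW : ArmClosed ends (mixedReal ends u p U Ah F σ q) h W)
include hup hdead hconnU hconnA hconnF hqR hqB hW

omit hdead hconnA hconnF in
/-- A u-arm lies in `W` iff `u` does. -/
lemma MixedBase.U_subset_iff [Nonempty ι] (j : ι) : U j ⊆ W ↔ u ∈ W := by
  obtain ⟨e, x, hex, hx⟩ := hb.u_adj_U j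
  have hxH := hb.armsAll_subset_hull hup hqR hqB (Or.inl (Or.inl (Set.mem_iUnion.2 ⟨j, hx⟩)))
  have huH := hb.u_mem_hull hup hqR hqB
  have hxh : x ≠ h := fun h' => hb.h_notMem_U j (h' ▸ hx)
  rcases subset_or_disjoint_of_armClosed hW
      (fun y hy => ⟨hb.armsAll_subset_hull hup hqR hqB (Or.inl (Or.inl (Set.mem_iUnion.2 ⟨j, hy⟩))),
        fun h' => hb.h_notMem_U j (h' ▸ hy)⟩) (hconnU j) with hsub | hdisj
  · refine ⟨fun _ => ?_, fun _ => hsub⟩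
    exact hW.closed e x u (ends_swap hex) (hsub hx) huH hb.hne_hu.symm
  · refine ⟨fun hsub => absurd (hsub hx) (hdisj x hx), fun huW => ?_⟩
    exact absurd (hW.closed e u x hex huW hxH hxh) (hdisj x hx)

omit hconnU hconnF in
/-- The h-piece lies in `W` iff `p` does, when `p` lies in the hull. -/
lemma MixedBase.Ah_subset_iff (hpH : p ∈ hull ends (mixedReal ends u p U Ah F σ q) h) :
    Ah ⊆ W ↔ p ∈ W := by
  obtain ⟨e, y, hey, hy⟩ := hdead
  have hyH := hb.armsAll_subset_hull hup hqR hqB (Or.inl (Or.inr hy))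
  have hyh : y ≠ h := fun h' => hb.h_notMem_Ah (h' ▸ hy)
  rcases subset_or_disjoint_of_armClosed hW
      (fun z hz => ⟨hb.armsAll_subset_hull hup hqR hqB (Or.inl (Or.inr hz)),
        fun h' => hb.h_notMem_Ah (h' ▸ hz)⟩) hconnA with hsub | hdisj
  · refine ⟨fun _ => ?_, fun _ => hsub⟩
    exact hW.closed e y p (ends_swap hey) (hsub hy) hpH hb.hne_hp.symm
  · refine ⟨fun hsub => absurd (hsub hy) (hdisj y hy), fun hpW => ?_⟩
    exact absurd (hW.closed e p y hey hpW hyH hyh) (hdisj y hy)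

omit hconnU hconnF in
/-- When the h-piece lies in `W`, so does `p` if `p` is in the hull; when `p` lies in `W`, so
does the h-piece. -/
lemma MixedBase.Ah_subset_of_mem (hpW : p ∈ W) : Ah ⊆ W := by
  have hpH : p ∈ hull ends (mixedReal ends u p U Ah F σ q) h := (hW.subset p hpW).1
  exact (hb.Ah_subset_iff hup hdead hconnA hqR hqB hW hpH).2 hpW

omit hdead hconnU hconnA hconnF in
/-- `u` lies in `W` when `p` does. -/
lemma MixedBase.u_mem_of_p_mem [Nonempty ι] (hpW : p ∈ W) : u ∈ W := by
  have huH := hb.u_mem_hull hup hqR hqB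
  obtain ⟨e, he⟩ := hup
  exact hW.closed e p u (ends_swap he) hpW huH hb.hne_hu.symm

omit hdead hconnU hconnA hconnF in
/-- A vertex outside `{h, u, p}` and the arms is not in `W`. -/
lemma MixedBase.not_mem_W_of_out {z : V} (hzh : z ≠ h) (hzu : z ≠ u) (hzp : z ≠ p)
    (hz : z ∉ armsAll U Ah F) : z ∉ W := by
  intro hzW
  have := hb.hull_mixedReal_subset hup hqR hqB (hW.subset z hzW).1
  rcases this with ((hz' | hz') | hz') | hz'
  · exact hzh hz'
  · exact hzu hz'
  · exact hzp hz'
  · exact hz hz'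

end Flip

end Orbit

end BigBlock

end Summit.Ventures.PercRepro2
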